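import Literature.Computability.Cryptography.GoldreichLevin
import Literature.Computability.Complexity.AveragingCounting
import HarnessLib

/-!
# From a distinguisher of the Goldreich–Levin bits to a predictor of one inner product
# (the computational XOR lemma, exact counting form)

Math layer of the proof of the Goldreich–Levin theorem for hiding functions with `O(log n)`
output bits (Liu–Pass 2020, Appendix, Thm [GL89]; Goldreich 2001, Thm 2.5.6 / §2.5.3): no
machines, only exact identities and inequalities between finite counts over
`BVec n = Fin n → 𝔽₂`.

* **XOR lemma, pointwise** (`xorLemma_pointwise`): for every `D : 𝔽₂^K → Bool` and `z ∈ 𝔽₂^K`,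
  `Σ_{∅ ≠ J ⊆ [K]} (2·#{u : pred_J(u) = ⊕_{j∈J} z_j} − 2^K) = 2^{K+1}·[D z] − 2·#{u : D u}`, where
  the **parity predictor** `pred_J(u) = ⊕_{j∈J} u_j ⊕ D(u) ⊕ 1` guesses the parity `⊕_J z` of the
  hidden string from one run of `D` on a uniformly random `u` (Vazirani–Vazirani / Goldreich:
  "if `D` accepts, guess the parity of the bits fed to it, else its complement"). Summing over
  the randomness of everything else, a distinguisher of `(W, Z)` from `(W, U_K)` with advantage
  `δ` yields, for a uniformly random nonempty `J`, a predictor of `⊕_{j∈J} Z_j` from `W` with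
  advantage `δ/(2^K − 1)` — polynomial loss for `K = O(log n)`.

The proof is Fourier analysis on `𝔽₂^K` written with the characters `χ(a) = (−1)^a ∈ ℤ`:
`χ(⊕_J v) = Π_{j∈J} χ(v_j)` and `Σ_J Π_{j∈J} χ(v_j) = Π_j (1 + χ(v_j)) = 2^K·[v = 0]`.

## References

* O. Goldreich, *Foundations of Cryptography I*, CUP 2001, §2.5.2–2.5.3 (Thm 2.5.6, hard-core
  functions of logarithmic length; the computational XOR lemma).
* U. Vazirani, V. Vazirani, *Efficient and secure pseudo-random number generation*, FOCS 1984.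
* Y. Liu, R. Pass, *On one-way functions and Kolmogorov complexity*, FOCS 2020
  (arXiv:2009.11514), Appendix, Thm [GL89].
-/

namespace Literature.Computability.Cryptography

open Finset Matrix Literature.Computability.Complexity

namespace GLPred

variable {K : ℕ}

/-! ### Characters of `𝔽₂` -/

/-- The character `χ(a) = (−1)^a ∈ ℤ` of `𝔽₂`. [folklore] -/
def chi (a : ZMod 2) : ℤ := if a = 0 then 1 else -1

/-- `χ 0 = 1`. [folklore] -/
@[simp] theorem chi_zero : chi 0 = 1 := rfl

/-- `χ 1 = −1`. [folklore] -/
@[simp] theorem chi_one : chi 1 = -1 := rfl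

/-- `χ` is multiplicative: `χ(a + b) = χ a · χ b`. [folklore] -/
theorem chi_add (a b : ZMod 2) : chi (a + b) = chi a * chi b := by
  fin_cases a <;> fin_cases b <;> rfl

/-- `χ` of a sum is the product of the `χ`'s. [folklore] -/
theorem chi_sum {ι : Type*} (J : Finset ι) (v : ι → ZMod 2) : chi (∑ j ∈ J, v j) = ∏ j ∈ J, chi (v j) := by
  classical
  induction J using Finset.induction_on with
  | empty => simp
  | insert a s ha ih => rw [Finset.sum_insert ha, Finset.prod_insert ha, chi_add, ih]

/-- `2·[a = 0] − 1 = χ a`. [folklore] -/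
theorem two_mul_indicator_sub_one (a : ZMod 2) : (2 * (if a = 0 then 1 else 0) - 1 : ℤ) = chi a := by
  fin_cases a <;> rfl

/-- `χ(bz b) = 1 − 2[b]` for a Boolean `b` (`bz b = if b then 1 else 0`). [folklore] -/
theorem chi_bool (b : Bool) : chi (if b then 1 else 0) = 1 - 2 * (if b then 1 else 0 : ℤ) := by
  cases b <;> rfl

/-- **Orthogonality of characters**: `Σ_{J ⊆ [K]} Π_{j∈J} χ(v_j) = 2^K·[v = 0]`. [folklore] -/
theorem sum_prod_chi (v : BVec K) :
    ∑ J : Finset (Fin K), ∏ j ∈ J, chi (v j) = if v = 0 then (2 : ℤ) ^ K else 0 := by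
  rw [← Finset.powerset_univ, ← Finset.prod_one_add]
  split_ifs with hv
  · subst hv
    simp
  · obtain ⟨j, hj⟩ : ∃ j, v j ≠ 0 := by
      by_contra h
      push Not at h
      exact hv (funext h)
    apply Finset.prod_eq_zero (Finset.mem_univ j)
    have : v j = 1 := by
      rcases (by decide : ∀ c : ZMod 2, c = 0 ∨ c = 1) (v j) with h | h
      · exact absurd h hj
      · exact h
    rw [this]; rfl

/-! ### The parity predictor and the XOR lemma -/

/-- **The parity predictor** built from one run of `D`: on coins `u ∈ 𝔽₂^K` it guesses the parity
`⊕_{j∈J}` of the hidden string as `⊕_{j∈J} u_j ⊕ D(u) ⊕ 1` ("the parity of what was fed to `D`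
if `D` accepts, its complement otherwise"). [Goldreich 2001, §2.5.2 (proof of the XOR lemma)]
[cite: Goldreich2001, Section 2.5.2 (XOR lemma)] -/
def parityPred (D : BVec K → Bool) (J : Finset (Fin K)) (u : BVec K) : ZMod 2 :=
  (∑ j ∈ J, u j) + (if D u then 1 else 0) + 1

/-- The sign form of one term: `2·[pred_J(u) = ⊕_J z] − 1 = −χ(⊕_{j∈J}(u_j + z_j))·χ(D u)`. [folklore] -/
theorem parityPred_sign (D : BVec K → Bool) (J : Finset (Fin K)) (u z : BVec K) :
    (2 * (if parityPred D J u = ∑ j ∈ J, z j then 1 else 0) - 1 : ℤ) =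
      -(∏ j ∈ J, chi (u j + z j)) * chi (if D u then 1 else 0) := by
  have key : (parityPred D J u = ∑ j ∈ J, z j) ↔ (parityPred D J u + ∑ j ∈ J, z j = 0) := by
    constructor
    · intro h; rw [h, CharTwo.add_self_eq_zero]
    · intro h
      calc parityPred D J u = parityPred D J u + ∑ j ∈ J, z j + ∑ j ∈ J, z j := by rw [add_assoc, CharTwo.add_self_eq_zero, add_zero]
        _ = ∑ j ∈ J, z j := by rw [h, zero_add]
  rw [show (if parityPred D J u = ∑ j ∈ J, z j then (1 : ℤ) else 0) =
      (if parityPred D J u + ∑ j ∈ J, z j = 0 then 1 else 0) from if_congr key rfl rfl,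
    two_mul_indicator_sub_one, parityPred, show (∑ j ∈ J, u j) + (if D u then 1 else 0) + 1 + ∑ j ∈ J, z j =
      (∑ j ∈ J, (u j + z j)) + (if D u then 1 else 0) + 1 by rw [Finset.sum_add_distrib]; ring,
    chi_add, chi_add, chi_sum, chi_one]
  ring

/-- **The XOR lemma, pointwise exact form.** For every `D : 𝔽₂^K → Bool` and every `z ∈ 𝔽₂^K`,
`Σ_{∅ ≠ J ⊆ [K]} (2·#{u : pred_J(u) = ⊕_{j∈J} z_j} − 2^K) = 2^{K+1}·[D z] − 2·#{u : D u}`: summed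
over the nonempty parities, the advantages of the parity predictors at the hidden string `z` add
up to (twice) the pointwise distinguishing gap `[D z] − Pr_u[D u]`. [Goldreich 2001, §2.5.2
(computational XOR lemma); Vazirani–Vazirani 1984] [cite: Goldreich2001, Section 2.5.2 (XOR lemma)] -/
theorem xorLemma_pointwise (D : BVec K → Bool) (z : BVec K) :
    ∑ J ∈ (univ : Finset (Finset (Fin K))).filter (fun J => J.Nonempty),
        (2 * ((univ.filter fun u : BVec K => parityPred D J u = ∑ j ∈ J, z j).card : ℤ) - 2 ^ K) =
      2 ^ (K + 1) * (if D z then 1 else 0) - 2 * ((univ.filter fun u : BVec K => D u).card : ℤ) := by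
  classical
  -- each term as a sum of signs over `u`
  have hterm : ∀ J : Finset (Fin K),
      (2 * ((univ.filter fun u : BVec K => parityPred D J u = ∑ j ∈ J, z j).card : ℤ) - 2 ^ K) =
        ∑ u : BVec K, -(∏ j ∈ J, chi (u j + z j)) * chi (if D u then 1 else 0) := by
    intro J
    rw [Finset.natCast_card_filter, Finset.mul_sum]
    have hK : (2 : ℤ) ^ K = ∑ _u : BVec K, (1 : ℤ) := by
      rw [Finset.sum_const, Finset.card_univ, nsmul_eq_mul, mul_one]
      simp [BVec, ZMod.card]
    rw [hK, ← Finset.sum_sub_distrib]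
    exact Finset.sum_congr rfl fun u _ => parityPred_sign D J u z
  -- the full sum over all `J` (orthogonality) and the `J = ∅` term
  have hfull : ∑ J : Finset (Fin K), ∑ u : BVec K, -(∏ j ∈ J, chi (u j + z j)) * chi (if D u then 1 else 0) =
      -(2 : ℤ) ^ K * chi (if D z then 1 else 0) := by
    rw [Finset.sum_comm]
    have : ∀ u : BVec K, ∑ J : Finset (Fin K), -(∏ j ∈ J, chi (u j + z j)) * chi (if D u then 1 else 0) =
        -(if u + z = 0 then (2 : ℤ) ^ K else 0) * chi (if D u then 1 else 0) := by
      intro u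
      rw [← sum_prod_chi (u + z)]
      simp only [Pi.add_apply, neg_mul, Finset.sum_neg_distrib, Finset.sum_mul]
    rw [Finset.sum_congr rfl fun u _ => this u]
    have hz : ∀ u : BVec K, (u + z = 0) ↔ u = z := fun u => by
      constructor
      · intro h
        funext i
        have hi := congrFun h i
        simp only [Pi.add_apply, Pi.zero_apply] at hi
        calc u i = u i + z i + z i := by rw [add_assoc, CharTwo.add_self_eq_zero, add_zero]
          _ = z i := by rw [hi, zero_add]
      · intro h
        rw [h]
        funext i
        exact CharTwo.add_self_eq_zero _
    simp_rw [hz]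
    rw [Finset.sum_eq_single z (fun u _ hu => by rw [if_neg hu]; ring) (fun h => absurd (Finset.mem_univ z) h), if_pos rfl]
  have hempty : ∑ u : BVec K, -(∏ j ∈ (∅ : Finset (Fin K)), chi (u j + z j)) * chi (if D u then 1 else 0) =
      ∑ u : BVec K, -chi (if D u then 1 else 0) := by simp
  -- nonempty = all minus empty
  have hsplit : ∑ J ∈ (univ : Finset (Finset (Fin K))).filter (fun J => J.Nonempty),
      ∑ u : BVec K, -(∏ j ∈ J, chi (u j + z j)) * chi (if D u then 1 else 0) =
      (∑ J : Finset (Fin K), ∑ u : BVec K, -(∏ j ∈ J, chi (u j + z j)) * chi (if D u then 1 else 0)) -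
        ∑ u : BVec K, -(∏ j ∈ (∅ : Finset (Fin K)), chi (u j + z j)) * chi (if D u then 1 else 0) := by
    have hf : (univ : Finset (Finset (Fin K))).filter (fun J => J.Nonempty) = univ.erase ∅ := by
      ext J; simp [Finset.nonempty_iff_ne_empty]
    rw [hf, Finset.sum_erase_eq_sub (Finset.mem_univ _)]
  rw [Finset.sum_congr rfl fun J _ => hterm J, hsplit, hfull, hempty]
  -- arithmetic: `χ(b) = 1 − 2[b]`
  simp only [chi_bool, Finset.sum_neg_distrib, Finset.sum_sub_distrib, Finset.sum_const, Finset.card_univ, nsmul_eq_mul,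
    mul_one, ← Finset.mul_sum, Finset.natCast_card_filter]
  have hK : (Fintype.card (BVec K) : ℤ) = 2 ^ K := by simp [BVec, ZMod.card]
  rw [hK]
  ring

/-! ### Goldreich–Levin, candidate form -/

/-- **Goldreich–Levin, candidate-of-the-true-guess form**: under the hypotheses of
`goldreich_levin_half`, for at least half of the seed tuples `s` Rackoff's candidate for the
*correct* guess `σ* = (⟨x, sᵗ⟩)_t` **is** `x` (not merely "`x` is on the list"): this is what the
proof of `goldreich_levin_core` establishes. [Arora–Barak 2009, Thm 9.12 (proof)] [cite: AroraBarak2009, Thm. 9.12] -/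
theorem goldreich_levin_cand {n kk : ℕ} (B : BVec n → ZMod 2) (x : BVec n) {γ : ℝ} (hγ : 0 < γ)
    (hB : (1 / 2 + γ) * Fintype.card (BVec n) ≤ ((univ.filter fun r : BVec n => B r = x ⬝ᵥ r).card : ℝ))
    (hk : 0 < kk) (hm : (n : ℝ) ≤ 2 * γ ^ 2 * (2 ^ kk - 1 : ℕ)) :
    (Fintype.card (Fin kk → BVec n) : ℝ) / 2 ≤
      (univ.filter fun s : Fin kk → BVec n => glCandidate B kk s (trueGuess x s) = x).card := by
  classical
  -- a seed is bad only if some coordinate's majority vote fails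
  have hsub : (univ.filter fun s : Fin kk → BVec n => ¬ glCandidate B kk s (trueGuess x s) = x) ⊆
      (univ : Finset (Fin n)).biUnion fun i =>
        univ.filter fun s : Fin kk → BVec n => 2 * correctVotes kk B x s i ≤ 2 ^ kk - 1 := by
    intro s hs
    rw [mem_filter] at hs
    rw [mem_biUnion]
    by_contra hall
    apply hs.2
    funext i
    apply glCandidate_trueGuess_apply
    by_contra hi
    exact hall ⟨i, mem_univ i, mem_filter.2 ⟨mem_univ s, not_lt.1 hi⟩⟩
  have hbad : ((univ.filter fun s : Fin kk → BVec n => ¬ glCandidate B kk s (trueGuess x s) = x).card : ℝ) ≤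
      n / (4 * γ ^ 2 * (2 ^ kk - 1 : ℕ)) * Fintype.card (Fin kk → BVec n) := by
    calc ((univ.filter fun s : Fin kk → BVec n => ¬ glCandidate B kk s (trueGuess x s) = x).card : ℝ)
        ≤ ((univ : Finset (Fin n)).biUnion fun i => univ.filter fun s : Fin kk → BVec n =>
            2 * correctVotes kk B x s i ≤ 2 ^ kk - 1).card := by exact_mod_cast card_le_card hsub
      _ ≤ ∑ i : Fin n, ((univ.filter fun s : Fin kk → BVec n =>
            2 * correctVotes kk B x s i ≤ 2 ^ kk - 1).card : ℝ) := by exact_mod_cast card_biUnion_le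
      _ ≤ ∑ _i : Fin n, Fintype.card (Fin kk → BVec n) / (4 * γ ^ 2 * (2 ^ kk - 1 : ℕ)) :=
          Finset.sum_le_sum fun i _ => card_badSeeds_le kk B x hγ hB hk i
      _ = n / (4 * γ ^ 2 * (2 ^ kk - 1 : ℕ)) * Fintype.card (Fin kk → BVec n) := by
          rw [Finset.sum_const, card_univ, Fintype.card_fin, nsmul_eq_mul]; ring
  have hm1 : (0 : ℝ) < (2 ^ kk - 1 : ℕ) := by
    have : 2 ≤ 2 ^ kk := by
      calc 2 = 2 ^ 1 := by norm_num
        _ ≤ 2 ^ kk := Nat.pow_le_pow_right (by norm_num) hk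
    have : 1 ≤ 2 ^ kk - 1 := by omega
    exact_mod_cast this
  have hcompl := Finset.card_filter_add_card_filter_not
    (s := (univ : Finset (Fin kk → BVec n))) (fun s => glCandidate B kk s (trueGuess x s) = x)
  rw [card_univ] at hcompl
  have hc : ((univ.filter fun s : Fin kk → BVec n => glCandidate B kk s (trueGuess x s) = x).card : ℝ) =
      Fintype.card (Fin kk → BVec n) -
        (univ.filter fun s : Fin kk → BVec n => ¬ glCandidate B kk s (trueGuess x s) = x).card := by
    rw [eq_sub_iff_add_eq]; exact_mod_cast hcompl
  rw [hc]
  have hfrac : (n : ℝ) / (4 * γ ^ 2 * (2 ^ kk - 1 : ℕ)) ≤ 1 / 2 := by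
    rw [div_le_iff₀ (by positivity)]; linarith
  have hΩ : (0 : ℝ) ≤ Fintype.card (Fin kk → BVec n) := Nat.cast_nonneg _
  nlinarith [mul_le_mul_of_nonneg_right hfrac hΩ]

/-! ### Embedding a query into a uniform seed block -/

variable {n : ℕ}

/-- `a + S + S = a` for vectors over `𝔽₂`. [folklore] -/
theorem add_add_self (a S : BVec n) : a + S + S = a := by
  funext i
  simp only [Pi.add_apply]
  rw [add_assoc, CharTwo.add_self_eq_zero, add_zero]

/-- **The embedding**: given the public randomness `ω'` (all `K` seed blocks) and a query point
`r`, replace block `j₀ ∈ J` so that the `J`-parity of the blocks becomes `r`: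
`σ_{j₀} := r + Σ_{j ∈ J ∖ j₀} ω'_j`, `σ_j := ω'_j` otherwise. [Goldreich 2001, §2.5.3 (proof of
Thm 2.5.6: "uniformly select `r^1,…,r^l` subject to `⊕_{j∈J} r^j = r`")] [cite: Goldreich2001, Thm. 2.5.6 (proof, Section 2.5.3)] -/
def embed {K : ℕ} (J : Finset (Fin K)) (j₀ : Fin K) (ω' : Fin K → BVec n) (r : BVec n) : Fin K → BVec n :=
  Function.update ω' j₀ (r + ∑ j ∈ J.erase j₀, ω' j)

/-- Off `j₀` the embedding is the public randomness. [folklore] -/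
theorem embed_of_ne {K : ℕ} {J : Finset (Fin K)} {j₀ j : Fin K} (h : j ≠ j₀) (ω' : Fin K → BVec n) (r : BVec n) :
    embed J j₀ ω' r j = ω' j := by
  simp [embed, Function.update_of_ne h]

/-- At `j₀`. [folklore] -/
theorem embed_self {K : ℕ} (J : Finset (Fin K)) (j₀ : Fin K) (ω' : Fin K → BVec n) (r : BVec n) :
    embed J j₀ ω' r j₀ = r + ∑ j ∈ J.erase j₀, ω' j := by
  simp [embed]

/-- **The `J`-parity of the embedded blocks is the query point**: `Σ_{j∈J} σ_j = r`. [folklore] -/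
theorem sum_embed {K : ℕ} {J : Finset (Fin K)} {j₀ : Fin K} (hj : j₀ ∈ J) (ω' : Fin K → BVec n) (r : BVec n) :
    ∑ j ∈ J, embed J j₀ ω' r j = r := by
  rw [← Finset.add_sum_erase J _ hj, embed_self,
    Finset.sum_congr rfl fun j hj' => embed_of_ne (Finset.ne_of_mem_erase hj') ω' r, add_add_self]

/-- **The embedding is a uniform sample**: re-indexing `(ω', r) ↦ (σ, ω'_{j₀})` is a bijection,
so sums of functions of the embedded blocks are `|𝔽₂ⁿ|` times the plain sums. [Goldreich 2001,
§2.5.3] [cite: Goldreich2001, Thm. 2.5.6 (proof, Section 2.5.3)] -/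
theorem sum_comp_embed {K : ℕ} {M : Type*} [AddCommMonoid M] (J : Finset (Fin K)) (j₀ : Fin K)
    (Φ : (Fin K → BVec n) → M) :
    ∑ p : (Fin K → BVec n) × BVec n, Φ (embed J j₀ p.1 p.2) = Fintype.card (BVec n) • ∑ σ : Fin K → BVec n, Φ σ := by
  classical
  -- the bijection and its inverse
  let e : (Fin K → BVec n) × BVec n ≃ (Fin K → BVec n) × BVec n :=
    { toFun := fun p => (embed J j₀ p.1 p.2, p.1 j₀)
      invFun := fun q => (Function.update q.1 j₀ q.2, q.1 j₀ + ∑ j ∈ J.erase j₀, q.1 j)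
      left_inv := by
        rintro ⟨ω', r⟩
        simp only [Prod.mk.injEq]
        refine ⟨?_, ?_⟩
        · unfold embed
          rw [Function.update_idem, Function.update_eq_self]
        · rw [embed_self, Finset.sum_congr rfl fun j hj' => embed_of_ne (Finset.ne_of_mem_erase hj') ω' r]
          rw [show r + ∑ j ∈ J.erase j₀, ω' j + ∑ j ∈ J.erase j₀, ω' j = r from add_add_self _ _]
      right_inv := by
        rintro ⟨σ, a⟩
        simp only [Prod.mk.injEq]
        refine ⟨?_, by simp⟩
        unfold embed
        rw [Function.update_idem,
          Finset.sum_congr (f := fun j => Function.update σ j₀ a j) (g := fun j => σ j) rfl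
            fun j hj' => Function.update_of_ne (Finset.ne_of_mem_erase hj') _ _,
          add_add_self, Function.update_eq_self] }
  calc ∑ p : (Fin K → BVec n) × BVec n, Φ (embed J j₀ p.1 p.2)
      = ∑ p : (Fin K → BVec n) × BVec n, Φ (e p).1 := rfl
    _ = ∑ q : (Fin K → BVec n) × BVec n, Φ q.1 := Fintype.sum_equiv e _ _ fun _ => rfl
    _ = Fintype.card (BVec n) • ∑ σ : Fin K → BVec n, Φ σ := by
        rw [Fintype.sum_prod_type, Finset.sum_comm]
        simp [Finset.sum_const]

/-! ### The predictor of one inner product built from the distinguisher -/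

/-- The coins of the predictor besides the parity set `J`: the fallback bit `β`, the public seed
blocks `ω'`, the bits `v` fed to `D` in place of the hard-core bits, and `D`'s own coins `c`.
[folklore] -/
abbrev Rest (n K : ℕ) (C : Type*) : Type _ := ZMod 2 × (Fin K → BVec n) × BVec K × C

/-- All coins of the predictor: a parity set `J ⊆ [K]` (uniform over all `2^K` subsets) and the
rest. [folklore] -/
abbrev Coins (n K : ℕ) (C : Type*) : Type _ := Finset (Fin K) × Rest n K C

/-- **The predictor `B` of `⟨x, r⟩` from `(y, r)`** built from a distinguisher
`D(y, σ, bits; c)` of the Goldreich–Levin bits (`Df σ v c`, the side information `y` being fixed):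
with coins `(J, β, ω', v, c)` — if `J = ∅` answer the coin `β`; otherwise embed `r` into uniform
seed blocks `σ` with `⊕_{j∈J} σ_j = r` (`embed`), run `D` once on `(y, σ, v)` and answer the parity
predictor's guess `⊕_{j∈J} v_j ⊕ D ⊕ 1` for `⊕_{j∈J} ⟨x, σ_j⟩ = ⟨x, r⟩`. [Goldreich 2001, §2.5.3
(proof of Thm 2.5.6) with §2.5.2 (XOR lemma)] [cite: Goldreich2001, Thm. 2.5.6 (proof, Section 2.5.3)] -/
def predB {K : ℕ} {C : Type*} (Df : (Fin K → BVec n) → BVec K → C → Bool) (ω : Coins n K C) (r : BVec n) : ZMod 2 :=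
  if h : ω.1.Nonempty then parityPred (fun v => Df (embed ω.1 (ω.1.min' h) ω.2.2.1 r) v ω.2.2.2.2) ω.1 ω.2.2.2.1
  else ω.2.1

/-- `Σ_{β ∈ 𝔽₂} (2[β = t] − 1) = 0`: a coin agrees with any fixed bit exactly half the time. [folklore] -/
theorem sum_sign_eq_zero (t : ZMod 2) : ∑ β : ZMod 2, (2 * (if β = t then 1 else 0) - 1 : ℤ) = 0 := by
  have hu : (univ : Finset (ZMod 2)) = {0, 1} := by decide
  rw [hu, Finset.sum_pair (by decide)]
  rcases (by decide : ∀ c : ZMod 2, c = 0 ∨ c = 1) t with rfl | rfl <;> decide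

variable {K : ℕ} {C : Type*} [Fintype C]

/-- The `J = ∅` part of the agreement count vanishes. [folklore] -/
theorem sum_empty_part (x : BVec n) :
    ∑ ρ : Rest n K C, ∑ r : BVec n, (2 * (if ρ.1 = x ⬝ᵥ r then 1 else 0) - 1 : ℤ) = 0 := by
  rw [Fintype.sum_prod_type]
  dsimp only
  have : ∀ β : ZMod 2, ∑ _b : (Fin K → BVec n) × BVec K × C, ∑ r : BVec n, (2 * (if β = x ⬝ᵥ r then 1 else 0) - 1 : ℤ) =
      Fintype.card ((Fin K → BVec n) × BVec K × C) • ∑ r : BVec n, (2 * (if β = x ⬝ᵥ r then 1 else 0) - 1 : ℤ) :=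
    fun β => by rw [Finset.sum_const, Finset.card_univ]
  simp only [this, ← Finset.smul_sum]
  rw [Finset.sum_comm]
  simp only [sum_sign_eq_zero, Finset.sum_const_zero, smul_zero]

/-- `Σ_v (2[P v] − 1) = 2·#{v : P v} − 2^K` over `𝔽₂^K`. [folklore] -/
theorem sum_sign_eq_card (P : BVec K → Prop) [DecidablePred P] :
    ∑ v : BVec K, (2 * (if P v then 1 else 0) - 1 : ℤ) = 2 * ((univ.filter P).card : ℤ) - 2 ^ K := by
  rw [Finset.sum_sub_distrib, ← Finset.mul_sum, Finset.natCast_card_filter, Finset.sum_const, Finset.card_univ]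
  simp [BVec, ZMod.card]

/-- The `J ≠ ∅` part of the agreement count: after the re-indexing of the embedding, it is
`2·|𝔽₂ⁿ|` times the advantage count of the parity predictor `pred_J` at the true bits
`z(σ) = (⟨x, σ_j⟩)_j`. [Goldreich 2001, §2.5.3] [cite: Goldreich2001, Thm. 2.5.6 (proof, Section 2.5.3)] -/
theorem sum_nonempty_part (Df : (Fin K → BVec n) → BVec K → C → Bool) (x : BVec n) {J : Finset (Fin K)} (hJ : J.Nonempty) :
    ∑ ρ : Rest n K C, ∑ r : BVec n,
      (2 * (if parityPred (fun v => Df (embed J (J.min' hJ) ρ.2.1 r) v ρ.2.2.2) J ρ.2.2.1 = x ⬝ᵥ r then 1 else 0) - 1 : ℤ) =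
      2 * Fintype.card (BVec n) * ∑ σ : Fin K → BVec n, ∑ c : C,
        (2 * ((univ.filter fun v : BVec K => parityPred (fun v => Df σ v c) J v = ∑ j ∈ J, x ⬝ᵥ σ j).card : ℤ) - 2 ^ K) := by
  classical
  set j₀ := J.min' hJ with hj₀
  -- the summand as a function of the embedded blocks
  set Φ : BVec K × C → (Fin K → BVec n) → ℤ := fun vc σ =>
    2 * (if parityPred (fun v => Df σ v vc.2) J vc.1 = ∑ j ∈ J, x ⬝ᵥ σ j then 1 else 0) - 1 with hΦ
  have hpt : ∀ (ρ : Rest n K C) (r : BVec n),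
      (2 * (if parityPred (fun v => Df (embed J j₀ ρ.2.1 r) v ρ.2.2.2) J ρ.2.2.1 = x ⬝ᵥ r then 1 else 0) - 1 : ℤ) =
        Φ ρ.2.2 (embed J j₀ ρ.2.1 r) := by
    intro ρ r
    simp only [hΦ]
    rw [← dotProduct_sum, sum_embed (Finset.min'_mem J hJ)]
  simp only [hpt]
  -- peel `β`, regroup `(ω', r)`, re-index by the embedding
  rw [Fintype.sum_prod_type]
  dsimp only
  have hβ : ∑ q : (Fin K → BVec n) × BVec K × C, ∑ r : BVec n, Φ q.2 (embed J j₀ q.1 r) =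
      Fintype.card (BVec n) • ∑ σ : Fin K → BVec n, ∑ vc : BVec K × C, Φ vc σ := by
    rw [Fintype.sum_prod_type]
    dsimp only
    rw [show (∑ ω' : Fin K → BVec n, ∑ vc : BVec K × C, ∑ r : BVec n, Φ vc (embed J j₀ ω' r)) =
        ∑ p : (Fin K → BVec n) × BVec n, ∑ vc : BVec K × C, Φ vc (embed J j₀ p.1 p.2) by
      rw [Fintype.sum_prod_type]
      exact Finset.sum_congr rfl fun ω' _ => Finset.sum_comm]
    exact sum_comp_embed J j₀ (fun σ => ∑ vc : BVec K × C, Φ vc σ)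
  rw [hβ]
  simp only [Finset.sum_const, Finset.card_univ, ZMod.card]
  -- the inner sum over `v`
  have hin : ∀ σ : Fin K → BVec n, ∑ vc : BVec K × C, Φ vc σ =
      ∑ c : C, (2 * ((univ.filter fun v : BVec K => parityPred (fun v => Df σ v c) J v = ∑ j ∈ J, x ⬝ᵥ σ j).card : ℤ) - 2 ^ K) := by
    intro σ
    rw [Fintype.sum_prod_type, Finset.sum_comm]
    refine Finset.sum_congr rfl fun c _ => ?_
    simp only [hΦ]
    exact sum_sign_eq_card _
  simp only [hin]
  ring

/-- **The agreement of the predictor, exactly.** Summed over all its coins and a uniform query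
point, the predictor's signed agreement with `⟨x, ·⟩` is `4·|𝔽₂ⁿ|·(2^K·Re − Id)`, where
`Re = #{(σ, c) : D(y, σ, GL(x,σ); c)}` and `Id = #{(σ, u, c) : D(y, σ, u; c)}` are the real and
ideal acceptance counts: in probabilities, `Pr[B = ⟨x,r⟩] = 1/2 + (Pr[D real] − Pr[D ideal])/2^K`.
[Goldreich 2001, §2.5.2–2.5.3 (Thm 2.5.6 via the XOR lemma)] [cite: Goldreich2001, Thm. 2.5.6 (proof, Section 2.5.3)] -/
theorem predB_agreement (Df : (Fin K → BVec n) → BVec K → C → Bool) (x : BVec n) :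
    ∑ ω : Coins n K C, ∑ r : BVec n, (2 * (if predB Df ω r = x ⬝ᵥ r then 1 else 0) - 1 : ℤ) =
      4 * Fintype.card (BVec n) *
        (2 ^ K * ((univ.filter fun q : (Fin K → BVec n) × C => Df q.1 (fun j => x ⬝ᵥ q.1 j) q.2).card : ℤ) -
          ((univ.filter fun q : (Fin K → BVec n) × BVec K × C => Df q.1 q.2.1 q.2.2).card : ℤ)) := by
  classical
  rw [Fintype.sum_prod_type, ← Finset.sum_filter_add_sum_filter_not univ (fun J : Finset (Fin K) => J.Nonempty)]
  -- `J = ∅`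
  have hE : (univ.filter fun J : Finset (Fin K) => ¬ J.Nonempty) = {∅} := by
    ext J; simp [Finset.not_nonempty_iff_eq_empty]
  rw [hE, Finset.sum_singleton]
  have h0 : ∑ ρ : Rest n K C, ∑ r : BVec n, (2 * (if predB Df (∅, ρ) r = x ⬝ᵥ r then 1 else 0) - 1 : ℤ) = 0 := by
    simp only [predB, Finset.not_nonempty_empty, dif_neg, not_false_eq_true]
    exact sum_empty_part x
  rw [h0, add_zero]
  -- `J ≠ ∅`: the embedding and the XOR lemma
  rw [Finset.sum_congr rfl fun J hJ => by
    have hJ' : J.Nonempty := (Finset.mem_filter.1 hJ).2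
    simp only [predB, hJ', dif_pos]
    exact sum_nonempty_part Df x hJ']
  rw [← Finset.mul_sum, Finset.sum_comm]
  -- now `Σ_σ Σ_{J ≠ ∅} Σ_c`; bring `c` out and apply the pointwise XOR lemma at `z(σ)`
  have hx : ∀ σ : Fin K → BVec n,
      ∑ J ∈ univ.filter (fun J : Finset (Fin K) => J.Nonempty), ∑ c : C,
        (2 * ((univ.filter fun v : BVec K => parityPred (fun v => Df σ v c) J v = ∑ j ∈ J, x ⬝ᵥ σ j).card : ℤ) - 2 ^ K) =
      ∑ c : C, (2 ^ (K + 1) * (if Df σ (fun j => x ⬝ᵥ σ j) c then 1 else 0) -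
        2 * ((univ.filter fun v : BVec K => Df σ v c).card : ℤ)) := by
    intro σ
    rw [Finset.sum_comm]
    exact Finset.sum_congr rfl fun c _ => xorLemma_pointwise (fun v => Df σ v c) (fun j => x ⬝ᵥ σ j)
  simp only [hx]
  -- counts of the product types as iterated sums, and the arithmetic
  have hRe : ((univ.filter fun q : (Fin K → BVec n) × C => Df q.1 (fun j => x ⬝ᵥ q.1 j) q.2).card : ℤ) =
      ∑ σ : Fin K → BVec n, ∑ c : C, (if Df σ (fun j => x ⬝ᵥ σ j) c then 1 else 0 : ℤ) := by
    rw [Finset.natCast_card_filter, Fintype.sum_prod_type]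
  have hId : ((univ.filter fun q : (Fin K → BVec n) × BVec K × C => Df q.1 q.2.1 q.2.2).card : ℤ) =
      ∑ σ : Fin K → BVec n, ∑ c : C, ((univ.filter fun v : BVec K => Df σ v c).card : ℤ) := by
    rw [Finset.natCast_card_filter, Fintype.sum_prod_type]
    refine Finset.sum_congr rfl fun σ _ => ?_
    rw [Fintype.sum_prod_type, Finset.sum_comm]
    refine Finset.sum_congr rfl fun c _ => ?_
    rw [Finset.natCast_card_filter]
  have hL : 2 * (Fintype.card (BVec n) : ℤ) * ∑ σ : Fin K → BVec n, ∑ c : C,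
      (2 ^ (K + 1) * (if Df σ (fun j => x ⬝ᵥ σ j) c then 1 else 0) - 2 * ((univ.filter fun v : BVec K => Df σ v c).card : ℤ)) =
      ∑ σ : Fin K → BVec n, ∑ c : C, 4 * (Fintype.card (BVec n) : ℤ) *
        (2 ^ K * (if Df σ (fun j => x ⬝ᵥ σ j) c then 1 else 0) - ((univ.filter fun v : BVec K => Df σ v c).card : ℤ)) := by
    rw [Finset.mul_sum]
    refine Finset.sum_congr rfl fun σ _ => ?_
    rw [Finset.mul_sum]
    refine Finset.sum_congr rfl fun c _ => ?_
    ring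
  have hR : 4 * (Fintype.card (BVec n) : ℤ) *
      (2 ^ K * ((univ.filter fun q : (Fin K → BVec n) × C => Df q.1 (fun j => x ⬝ᵥ q.1 j) q.2).card : ℤ) -
        ((univ.filter fun q : (Fin K → BVec n) × BVec K × C => Df q.1 q.2.1 q.2.2).card : ℤ)) =
      ∑ σ : Fin K → BVec n, ∑ c : C, 4 * (Fintype.card (BVec n) : ℤ) *
        (2 ^ K * (if Df σ (fun j => x ⬝ᵥ σ j) c then 1 else 0) - ((univ.filter fun v : BVec K => Df σ v c).card : ℤ)) := by
    rw [hRe, hId, Finset.mul_sum, ← Finset.sum_sub_distrib, Finset.mul_sum]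
    refine Finset.sum_congr rfl fun σ _ => ?_
    rw [Finset.mul_sum, ← Finset.sum_sub_distrib, Finset.mul_sum]
  rw [hL, hR]

/-! ### From the distinguishing gap to the inverter's success count -/

section Inverter

variable {X R : Type*} [Fintype X] [Fintype R]

/-- The number of coin tuples of the predictor. [folklore] -/
theorem card_Coins : Fintype.card (Coins n K C) =
    2 ^ K * (2 * (Fintype.card (Fin K → BVec n) * (2 ^ K * Fintype.card C))) := by
  simp only [Coins, Rest, Fintype.card_prod, Fintype.card_finset, Fintype.card_fin, ZMod.card]
  congr 2
  congr 2
  rw [Fintype.card_fun, ZMod.card, Fintype.card_fin]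

/-- **The predictor agrees with `⟨x, ·⟩` on a `1/2 + δ/2^K` fraction** of (instance, coins, query),
when the distinguisher's gap `Pr[D real] − Pr[D ideal]` is at least `δ` (hypothesis `hadv`, in
counts: `Re` over `(x, ρ, σ, c)` with the true bits, `Id` over `(x, ρ, σ, u, c)`).
[Goldreich 2001, §2.5.2–2.5.3] [cite: Goldreich2001, Thm. 2.5.6 (proof, Section 2.5.3)] -/
theorem card_agree_ge (Df : X → R → (Fin K → BVec n) → BVec K → C → Bool) (sec : X → BVec n) {δ : ℝ}
    (hadv : δ * (Fintype.card X * Fintype.card R * Fintype.card (Fin K → BVec n) * 2 ^ K * Fintype.card C) ≤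
      2 ^ K * ((univ.filter fun q : X × R × (Fin K → BVec n) × C =>
          Df q.1 q.2.1 q.2.2.1 (fun j => sec q.1 ⬝ᵥ q.2.2.1 j) q.2.2.2).card : ℝ) -
        ((univ.filter fun q : X × R × (Fin K → BVec n) × BVec K × C => Df q.1 q.2.1 q.2.2.1 q.2.2.2.1 q.2.2.2.2).card : ℝ)) :
    (1 / 2 + δ / 2 ^ K) * (Fintype.card (X × R × Coins n K C) * Fintype.card (BVec n)) ≤
      ((univ.filter fun p : (X × R × Coins n K C) × BVec n =>
        predB (Df p.1.1 p.1.2.1) p.1.2.2 p.2 = sec p.1.1 ⬝ᵥ p.2).card : ℝ) := by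
  classical
  -- the signed agreement sum, two ways
  set P : (X × R × Coins n K C) × BVec n → Prop := fun p => predB (Df p.1.1 p.1.2.1) p.1.2.2 p.2 = sec p.1.1 ⬝ᵥ p.2 with hP
  have hT1 : ∑ p : (X × R × Coins n K C) × BVec n, (2 * (if P p then 1 else 0) - 1 : ℤ) =
      2 * ((univ.filter P).card : ℤ) - Fintype.card (X × R × Coins n K C) * Fintype.card (BVec n) := by
    rw [Finset.sum_sub_distrib, ← Finset.mul_sum, Finset.natCast_card_filter, Finset.sum_const, Finset.card_univ,
      Fintype.card_prod]
    simp [hP]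
  have hT2 : ∑ p : (X × R × Coins n K C) × BVec n, (2 * (if P p then 1 else 0) - 1 : ℤ) =
      4 * Fintype.card (BVec n) * (2 ^ K * ((univ.filter fun q : X × R × (Fin K → BVec n) × C =>
          Df q.1 q.2.1 q.2.2.1 (fun j => sec q.1 ⬝ᵥ q.2.2.1 j) q.2.2.2).card : ℤ) -
        ((univ.filter fun q : X × R × (Fin K → BVec n) × BVec K × C => Df q.1 q.2.1 q.2.2.1 q.2.2.2.1 q.2.2.2.2).card : ℤ)) := by
    simp only [hP]
    rw [Fintype.sum_prod_type, Fintype.sum_prod_type]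
    dsimp only
    simp only [Fintype.sum_prod_type (f := fun a : R × Coins n K C => ∑ r : BVec n,
      (2 * (if predB (Df _ a.1) a.2 r = sec _ ⬝ᵥ r then 1 else 0) - 1 : ℤ)), predB_agreement]
    rw [Finset.natCast_card_filter, Finset.natCast_card_filter, Fintype.sum_prod_type, Fintype.sum_prod_type]
    simp only [Fintype.sum_prod_type (f := fun q : R × (Fin K → BVec n) × C =>
        (if Df _ q.1 q.2.1 (fun j => sec _ ⬝ᵥ q.2.1 j) q.2.2 then 1 else 0 : ℤ)),
      Fintype.sum_prod_type (f := fun q : R × (Fin K → BVec n) × BVec K × C =>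
        (if Df _ q.1 q.2.1 q.2.2.1 q.2.2.2 then 1 else 0 : ℤ))]
    rw [Finset.mul_sum, ← Finset.sum_sub_distrib, Finset.mul_sum]
    refine Finset.sum_congr rfl fun x _ => ?_
    rw [Finset.mul_sum, ← Finset.sum_sub_distrib, Finset.mul_sum]
    refine Finset.sum_congr rfl fun ρ _ => ?_
    rw [Finset.natCast_card_filter, Finset.natCast_card_filter]
  have hZ : (2 * ((univ.filter P).card : ℝ) - Fintype.card (X × R × Coins n K C) * Fintype.card (BVec n)) =
      4 * Fintype.card (BVec n) * (2 ^ K * ((univ.filter fun q : X × R × (Fin K → BVec n) × C =>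
          Df q.1 q.2.1 q.2.2.1 (fun j => sec q.1 ⬝ᵥ q.2.2.1 j) q.2.2.2).card : ℝ) -
        ((univ.filter fun q : X × R × (Fin K → BVec n) × BVec K × C => Df q.1 q.2.1 q.2.2.1 q.2.2.2.1 q.2.2.2.2).card : ℝ)) := by
    have h := hT1.symm.trans hT2
    exact_mod_cast h
  -- the size of the row space
  have hA : (Fintype.card (X × R × Coins n K C) : ℝ) =
      Fintype.card X * Fintype.card R * (2 ^ K * (2 * (Fintype.card (Fin K → BVec n) * (2 ^ K * Fintype.card C)))) := by
    rw [Fintype.card_prod, Fintype.card_prod, card_Coins]; push_cast; ring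
  have hB : (0 : ℝ) ≤ Fintype.card (BVec n) := Nat.cast_nonneg _
  have h2K : (0 : ℝ) < 2 ^ K := by positivity
  -- combine
  have hmain : δ / 2 ^ K * (Fintype.card (X × R × Coins n K C) * Fintype.card (BVec n)) ≤
      ((univ.filter P).card : ℝ) - Fintype.card (X × R × Coins n K C) * Fintype.card (BVec n) / 2 := by
    have := mul_le_mul_of_nonneg_left hadv (show (0 : ℝ) ≤ 4 * Fintype.card (BVec n) by positivity)
    rw [← hZ] at this
    rw [hA]
    rw [hA] at this
    field_simp
    nlinarith [this, h2K]
  linarith [hmain]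

/-- **The Goldreich–Levin inverter succeeds with probability `≥ δ / (2^{K+1}·2^k)`.** If the
distinguisher's gap is at least `δ > 0` and the number `2^k − 1` of pairwise independent queries
satisfies `n ≤ 2(δ/2^{K+1})²(2^k − 1)`, then Rackoff's candidate computed with the predictor
`B` (coins `ω`), seeds `s` and a guess `τ` of the `k` bits `⟨x, sᵗ⟩` equals the secret `x` for at
least a `δ/(2^{K+1}·2^k)` fraction of `(x, ρ, ω, s, τ)`: averaging over `(x, ρ, ω)` (a `δ/2^K`
fraction have agreement `≥ 1/2 + δ/2^{K+1}`, `card_goodRows_ge`), Goldreich–Levin on each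
(`goldreich_levin_cand`: half of the seeds), and the guess is right with probability `2^{-k}`.
[Goldreich 2001, Thm 2.5.6 with §2.5.2; Arora–Barak 2009, Thm 9.12] [cite: Goldreich2001, Thm. 2.5.6 (proof, Section 2.5.3)] -/
theorem inverter_count (Df : X → R → (Fin K → BVec n) → BVec K → C → Bool) (sec : X → BVec n)
    {δ : ℝ} (hδ : 0 < δ)
    (hadv : δ * (Fintype.card X * Fintype.card R * Fintype.card (Fin K → BVec n) * 2 ^ K * Fintype.card C) ≤
      2 ^ K * ((univ.filter fun q : X × R × (Fin K → BVec n) × C =>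
          Df q.1 q.2.1 q.2.2.1 (fun j => sec q.1 ⬝ᵥ q.2.2.1 j) q.2.2.2).card : ℝ) -
        ((univ.filter fun q : X × R × (Fin K → BVec n) × BVec K × C => Df q.1 q.2.1 q.2.2.1 q.2.2.2.1 q.2.2.2.2).card : ℝ))
    {kk : ℕ} (hk : 0 < kk) (hm : (n : ℝ) ≤ 2 * (δ / 2 ^ K / 2) ^ 2 * (2 ^ kk - 1 : ℕ)) :
    δ / 2 ^ K / 2 / 2 ^ kk * Fintype.card ((X × R × Coins n K C) × (Fin kk → BVec n) × (Fin kk → ZMod 2)) ≤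
      ((univ.filter fun t : (X × R × Coins n K C) × (Fin kk → BVec n) × (Fin kk → ZMod 2) =>
        glCandidate (fun r => predB (Df t.1.1 t.1.2.1) t.1.2.2 r) kk t.2.1 t.2.2 = sec t.1.1).card : ℝ) := by
  classical
  set ε : ℝ := δ / 2 ^ K with hε
  have hε0 : 0 < ε := by positivity
  -- Step 1: a `≥ ε` fraction of the rows `a = (x, ρ, ω)` has agreement `≥ 1/2 + ε/2`
  have hagree := card_agree_ge Df sec hadv
  rw [← hε] at hagree
  have hrows := card_goodRows_ge (A := X × R × Coins n K C) (B := BVec n)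
    (fun a r => predB (Df a.1 a.2.1) a.2.2 r = sec a.1 ⬝ᵥ r) hε0.le
    (by rw [Fintype.card_prod] at hagree ⊢; push_cast at hagree ⊢; simpa using hagree)
  set good := univ.filter fun a : X × R × Coins n K C =>
    (1 / 2 + ε / 2) * Fintype.card (BVec n) ≤ ((univ.filter fun r => predB (Df a.1 a.2.1) a.2.2 r = sec a.1 ⬝ᵥ r).card : ℝ)
    with hgood
  -- Step 2: on a good row, half of the seeds make the true-guess candidate equal to the secret
  have hGL : ∀ a ∈ good, (Fintype.card (Fin kk → BVec n) : ℝ) / 2 ≤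
      ((univ.filter fun s : Fin kk → BVec n =>
        glCandidate (fun r => predB (Df a.1 a.2.1) a.2.2 r) kk s (trueGuess (sec a.1) s) = sec a.1).card : ℝ) := by
    intro a ha
    have hBa := (mem_filter.1 ha).2
    exact goldreich_levin_cand (fun r => predB (Df a.1 a.2.1) a.2.2 r) (sec a.1) (γ := ε / 2) (by positivity) hBa hk hm
  -- Step 3: count the successes `(a, s, τ)` through `(a, s) ↦ (a, s, trueGuess)`
  set succ := univ.filter fun t : (X × R × Coins n K C) × (Fin kk → BVec n) × (Fin kk → ZMod 2) =>
    glCandidate (fun r => predB (Df t.1.1 t.1.2.1) t.1.2.2 r) kk t.2.1 t.2.2 = sec t.1.1 with hsucc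
  have hinj : (good.sigma fun a => univ.filter fun s : Fin kk → BVec n =>
        glCandidate (fun r => predB (Df a.1 a.2.1) a.2.2 r) kk s (trueGuess (sec a.1) s) = sec a.1).card ≤ succ.card := by
    refine Finset.card_le_card_of_injOn (fun q => (q.1, q.2, trueGuess (sec q.1.1) q.2)) (fun q hq => ?_) ?_
    · rw [Finset.mem_coe, Finset.mem_sigma] at hq
      rw [Finset.mem_coe]
      simp only [hsucc, mem_filter, mem_univ, true_and]
      exact (mem_filter.1 hq.2).2
    · rintro ⟨a, s⟩ _ ⟨a', s'⟩ _ h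
      simp only [Prod.mk.injEq] at h
      obtain ⟨rfl, rfl, -⟩ := h
      rfl
  have hsum : (good.card : ℝ) * ((Fintype.card (Fin kk → BVec n) : ℝ) / 2) ≤
      ((good.sigma fun a => univ.filter fun s : Fin kk → BVec n =>
        glCandidate (fun r => predB (Df a.1 a.2.1) a.2.2 r) kk s (trueGuess (sec a.1) s) = sec a.1).card : ℝ) := by
    rw [Finset.card_sigma, Nat.cast_sum, ← nsmul_eq_mul, ← Finset.sum_const]
    exact Finset.sum_le_sum hGL
  -- Step 4: arithmetic
  have htot : (Fintype.card ((X × R × Coins n K C) × (Fin kk → BVec n) × (Fin kk → ZMod 2)) : ℝ) =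
      Fintype.card (X × R × Coins n K C) * Fintype.card (Fin kk → BVec n) * 2 ^ kk := by
    simp only [Fintype.card_prod, Fintype.card_fun, ZMod.card, Fintype.card_fin]; push_cast; ring
  rw [htot]
  have hS : (0 : ℝ) ≤ Fintype.card (Fin kk → BVec n) := Nat.cast_nonneg _
  have h2k : (0 : ℝ) < 2 ^ kk := by positivity
  calc ε / 2 / 2 ^ kk * (Fintype.card (X × R × Coins n K C) * Fintype.card (Fin kk → BVec n) * 2 ^ kk)
      = (ε * Fintype.card (X × R × Coins n K C)) * ((Fintype.card (Fin kk → BVec n) : ℝ) / 2) := by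
        field_simp
    _ ≤ (good.card : ℝ) * ((Fintype.card (Fin kk → BVec n) : ℝ) / 2) := by gcongr
    _ ≤ _ := hsum
    _ ≤ (succ.card : ℝ) := by exact_mod_cast hinj

end Inverter

end GLPred

end Literature.Computability.Cryptography
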